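import Mathlib
import Literature.MathematicalPhysics.StatisticalMechanics.Crystallization
import Literature.MathematicalPhysics.StatisticalMechanics.StickyChain

/-!
# Crux `ExactCertificate` (stmt-AtomisticToContinuum-11959), line `closure-makes-nogap-exact`,
# Transfer1D skeleton, wave 2 — stub `stub_periodicPosType1D`: the periodic Bochner inequality on the line

Support file (`--supports stmt-AtomisticToContinuum-11959`); nothing here closes the 3-D crux.

For a radial kernel `f` of positive type on `ℝ¹` (all finite Gram forms `Σ w_i w_j f(|y_i − y_j|) ≥ 0`) and a
periodic configuration `Q = F + ℤv` of the line on which the site sums `Σ_{z ∈ Q, z ≠ y} f(|y − z|)` are summable,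

  `f(0)/2 + e_f(Q) ≥ 0`,

i.e. the `Q`-sum of `f` INCLUDING the self-term is non-negative.  This is what makes the d = 1 exact certificate
prove `e(aℤ) ≤ e(Q)` for EVERY periodic competitor `Q` without trial states.  Proof: unit weights on the `#F·K`
points `y + jv` (`y ∈ F`, `0 ≤ j < K`) give `0 ≤ Σ_{x,y∈F} Σ_{i,j<K} f(|x − y − (j−i)v|) = Σ_{d<K}(K−d)·e_d` with
`e_0 = Σ_{x,y} c_{xy}(0)`, `e_d = Σ_{x,y}(c_{xy}(d) + c_{xy}(−d))`, `c_{xy}(n) = f(|x − y − nv|)`; dividing by `K` and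
letting `K → ∞` (Fejér/Cesàro means of the absolutely convergent series `Σ_d e_d`, the registered statement
`stub_cesaro`, a hypothesis here) gives `0 ≤ Σ_d e_d = Σ_{x∈F}Σ_{(y,n)∈F×ℤ} f(|x − y − nv|) = #F·f(0) + Σ_{x∈F} S(x)
= #F·(f(0) + 2e_f(Q))`.  The rank-one structure `Q.lattice = ℤv` is the registered statement
`stub_latticeGenerator1D` (hypothesis).
-/

noncomputable section

namespace Summit.AtomisticToContinuum.Crystallization.Theorems.ThreeConeCertificateExactCertificate.Transfer1D

open Literature.MathematicalPhysics.StatisticalMechanics Filter Topology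
open scoped BigOperators

/-! ## Finite Gram forms indexed by an arbitrary finite type -/

/-- Positive type of a radial kernel, re-indexed by an arbitrary `Fintype`. [folklore] -/
theorem ppos_pd_fintype {f : ℝ → ℝ}
    (hpd : ∀ (n : ℕ) (y : Fin n → EuclideanSpace ℝ (Fin 1)) (w : Fin n → ℝ),
      0 ≤ ∑ i, ∑ j, w i * w j * f (dist (y i) (y j)))
    {ι : Type*} [Fintype ι] (p : ι → EuclideanSpace ℝ (Fin 1)) (w : ι → ℝ) :
    0 ≤ ∑ i, ∑ j, w i * w j * f (dist (p i) (p j)) := by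
  classical
  set e := Fintype.equivFin ι
  have h := hpd (Fintype.card ι) (p ∘ e.symm) (w ∘ e.symm)
  have h1 : ∑ i, ∑ j, w i * w j * f (dist (p i) (p j)) =
      ∑ i : Fin (Fintype.card ι), ∑ j : Fin (Fintype.card ι),
        (w ∘ e.symm) i * (w ∘ e.symm) j * f (dist ((p ∘ e.symm) i) ((p ∘ e.symm) j)) := by
    rw [← e.symm.sum_comp]
    refine Finset.sum_congr rfl fun i _ => ?_
    rw [← e.symm.sum_comp]
    rfl
  rw [h1]
  exact h

/-! ## The counting identity `Σ_{i,j<K} ψ(j−i) = Σ_{d<K} (K−d)·e_d` -/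

/-- Folding a `ℤ`-indexed sequence to `ℕ`: `e_0 = ψ 0`, `e_d = ψ d + ψ (−d)` (`d ≥ 1`). Summable if `ψ` is. [folklore] -/
theorem ppos_fold_summable {ψ : ℤ → ℝ} (hψ : Summable ψ) :
    Summable (fun d : ℕ => if d = 0 then ψ 0 else ψ d + ψ (-(d : ℤ))) := by
  have h1 : Summable (fun d : ℕ => ψ d) := hψ.comp_injective Nat.cast_injective
  have h2 : Summable (fun d : ℕ => ψ (-(d : ℤ))) :=
    hψ.comp_injective (fun a b h => by exact_mod_cast neg_injective h)
  have h3 : Summable (fun d : ℕ => if d = 0 then ψ 0 else (0 : ℝ)) := (hasSum_ite_eq 0 (ψ 0)).summable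
  refine ((h1.add h2).sub h3).congr fun d => ?_
  by_cases hd : d = 0
  · subst hd; simp
  · simp [hd]

/-- … and its sum is the `ℤ`-sum: `Σ_d e_d = Σ_{n ∈ ℤ} ψ n`. [folklore] -/
theorem ppos_fold_tsum {ψ : ℤ → ℝ} (hψ : Summable ψ) :
    ∑' d : ℕ, (if d = 0 then ψ 0 else ψ d + ψ (-(d : ℤ))) = ∑' n : ℤ, ψ n := by
  have h1 : Summable (fun d : ℕ => ψ d) := hψ.comp_injective Nat.cast_injective
  have h2 : Summable (fun d : ℕ => ψ (-(d : ℤ))) :=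
    hψ.comp_injective (fun a b h => by exact_mod_cast neg_injective h)
  have h2' : Summable (fun d : ℕ => ψ (-((d : ℤ) + 1))) := by
    have := (summable_nat_add_iff 1).2 h2
    refine this.congr fun d => ?_
    push_cast
    ring_nf
  have h3 : HasSum (fun d : ℕ => if d = 0 then ψ 0 else (0 : ℝ)) (ψ 0) := hasSum_ite_eq 0 (ψ 0)
  have hpt : ∀ d : ℕ, (if d = 0 then ψ 0 else ψ d + ψ (-(d : ℤ))) =
      ψ d + ψ (-(d : ℤ)) - (if d = 0 then ψ 0 else 0) := fun d => by
    by_cases hd : d = 0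
    · subst hd; simp
    · simp [hd]
  rw [tsum_congr hpt, ((h1.hasSum.add h2.hasSum).sub h3).tsum_eq, tsum_of_nat_of_neg_add_one h1 h2',
    h2.tsum_eq_zero_add]
  simp only [Nat.cast_zero, neg_zero]
  have : ∑' d : ℕ, ψ (-((((d + 1 : ℕ)) : ℤ))) = ∑' d : ℕ, ψ (-((d : ℤ) + 1)) :=
    tsum_congr fun d => by push_cast; ring_nf
  rw [this]
  ring

/-- The counting identity: over the square `[0,K)²` the difference `j − i` takes the value `±d` exactly `K − d` times:
`Σ_{i<K}Σ_{j<K} ψ(j − i) = Σ_{d<K} (K − d)·e_d`. [folklore] -/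
theorem ppos_counting (ψ : ℤ → ℝ) (K : ℕ) :
    ∑ i : Fin K, ∑ j : Fin K, ψ ((j : ℤ) - (i : ℤ)) =
      ∑ d ∈ Finset.range K, ((K : ℝ) - d) * (if d = 0 then ψ 0 else ψ d + ψ (-(d : ℤ))) := by
  induction K with
  | zero => simp
  | succ K ih =>
    -- peel off the last row and the last column
    rw [Fin.sum_univ_castSucc]
    simp only [Fin.sum_univ_castSucc, Fin.val_castSucc, Fin.val_last]
    rw [Finset.sum_add_distrib, ih]
    -- the two boundary sums, reindexed by `d + 1 = K − i`
    have hrow : ∑ i : Fin K, ψ (((K : ℕ) : ℤ) - ((i : ℕ) : ℤ)) = ∑ d ∈ Finset.range K, ψ ((d : ℤ) + 1) := by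
      rw [Fin.sum_univ_eq_sum_range (fun i => ψ (((K : ℕ) : ℤ) - ((i : ℕ) : ℤ))) K,
        ← Finset.sum_range_reflect]
      refine Finset.sum_congr rfl fun d hd => ?_
      have hd' := Finset.mem_range.1 hd
      congr 1
      push_cast [Nat.sub_sub, Nat.cast_sub (by omega : 1 + d ≤ K)]
      ring
    have hcol : ∑ j : Fin K, ψ (((j : ℕ) : ℤ) - ((K : ℕ) : ℤ)) = ∑ d ∈ Finset.range K, ψ (-((d : ℤ) + 1)) := by
      rw [Fin.sum_univ_eq_sum_range (fun j => ψ (((j : ℕ) : ℤ) - ((K : ℕ) : ℤ))) K,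
        ← Finset.sum_range_reflect]
      refine Finset.sum_congr rfl fun d hd => ?_
      have hd' := Finset.mem_range.1 hd
      congr 1
      push_cast [Nat.sub_sub, Nat.cast_sub (by omega : 1 + d ≤ K)]
      ring
    rw [hrow, hcol, sub_self]
    -- right-hand side at `K + 1`
    rw [Finset.sum_range_succ]
    have hsplit : ∑ d ∈ Finset.range K, (((K + 1 : ℕ) : ℝ) - d) * (if d = 0 then ψ 0 else ψ d + ψ (-(d : ℤ)))
        = ∑ d ∈ Finset.range K, ((K : ℝ) - d) * (if d = 0 then ψ 0 else ψ d + ψ (-(d : ℤ)))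
          + ∑ d ∈ Finset.range K, (if d = 0 then ψ 0 else ψ d + ψ (-(d : ℤ))) := by
      rw [← Finset.sum_add_distrib]
      refine Finset.sum_congr rfl fun d _ => ?_
      push_cast
      ring
    rw [hsplit]
    -- `Σ_{d<K} e_d + e_K = ψ 0 + Σ_{d<K} (ψ(d+1) + ψ(−(d+1)))`
    have hshift : ∑ d ∈ Finset.range K, (if d = 0 then ψ 0 else ψ d + ψ (-(d : ℤ)))
        + (((K + 1 : ℕ) : ℝ) - ((K : ℕ) : ℝ)) * (if K = 0 then ψ 0 else ψ K + ψ (-(K : ℤ)))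
        = ψ 0 + ∑ d ∈ Finset.range K, (ψ ((d : ℤ) + 1) + ψ (-((d : ℤ) + 1))) := by
      have h1 : (((K + 1 : ℕ) : ℝ) - ((K : ℕ) : ℝ)) = 1 := by push_cast; ring
      rw [h1, one_mul]
      have h2 : ∑ d ∈ Finset.range (K + 1), (if d = 0 then ψ 0 else ψ d + ψ (-(d : ℤ)))
          = ψ 0 + ∑ d ∈ Finset.range K, (ψ ((d : ℤ) + 1) + ψ (-((d : ℤ) + 1))) := by
        rw [Finset.sum_range_succ']
        simp only [Nat.cast_add, Nat.cast_one, Nat.add_eq_zero_iff, one_ne_zero, and_false, ↓reduceIte,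
          add_comm]
      rw [← h2, Finset.sum_range_succ]
    have h4 : ∑ d ∈ Finset.range K, (ψ ((d : ℤ) + 1) + ψ (-((d : ℤ) + 1)))
        = ∑ d ∈ Finset.range K, ψ ((d : ℤ) + 1) + ∑ d ∈ Finset.range K, ψ (-((d : ℤ) + 1)) :=
      Finset.sum_add_distrib
    linarith [hshift, h4]

/-! ## The periodic Bochner inequality -/

/-- **STUB `stub_periodicPosType1D`** (registered on stmt-AtomisticToContinuum-11959, Transfer1D skeleton, wave 2): the
PERIODIC BOCHNER INEQUALITY on the line.  For a radial kernel `f` of positive type on `ℝ¹` and a periodic configuration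
`Q` of the line with summable site sums of `f`, `0 ≤ f(0)/2 + e_f(Q)`.  Hypotheses: the registered statements of
`stub_latticeGenerator1D` (rank-one lattices are `ℤv`) and `stub_cesaro` (Fejér means).  See the module docstring for
the proof. [folklore] -/
theorem stub_periodicPosType1D :
    (∀ Q : PeriodicConfiguration 1, ∃ v : EuclideanSpace ℝ (Fin 1), 0 < v 0 ∧
      ∀ g : EuclideanSpace ℝ (Fin 1), g ∈ Q.lattice ↔ ∃ n : ℤ, g = n • v) →
    (∀ e : ℕ → ℝ, Summable e →
      Filter.Tendsto (fun N : ℕ => (∑ d ∈ Finset.range N, ((N : ℝ) - d) * e d) / N)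
        Filter.atTop (nhds (∑' d : ℕ, e d))) →
    ∀ (Q : PeriodicConfiguration 1) (f : ℝ → ℝ),
    (∀ (n : ℕ) (y : Fin n → EuclideanSpace ℝ (Fin 1)) (w : Fin n → ℝ),
      0 ≤ ∑ i, ∑ j, w i * w j * f (dist (y i) (y j))) →
    (∀ y : EuclideanSpace ℝ (Fin 1), y ∈ Q.points →
      Summable (fun z : {z : EuclideanSpace ℝ (Fin 1) // z ∈ Q.points ∧ z ≠ y} => f (dist y z.1))) →
    0 ≤ f 0 / 2 + Q.energyPerParticle f := by
  intro hgen hces Q f hpd hsum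
  obtain ⟨v, hv0, hmemz⟩ := hgen Q
  have hvne : v ≠ 0 := fun h => by rw [h] at hv0; simp at hv0
  -- real scalars throughout
  have hmem : ∀ g : EuclideanSpace ℝ (Fin 1), g ∈ Q.lattice ↔ ∃ n : ℤ, g = (n : ℝ) • v := by
    intro g
    rw [hmemz g]
    simp only [Int.cast_smul_eq_zsmul]
  haveI : DecidableEq (Q.motif × ℤ) := Classical.decEq _
  have hmpos : 0 < (Q.motif.card : ℝ) := by exact_mod_cast Q.motif_nonempty.card_pos
  -- uniqueness of the representation `y + n v`
  have huniq : ∀ y ∈ Q.motif, ∀ y' ∈ Q.motif, ∀ n n' : ℤ,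
      y + (n : ℝ) • v = y' + (n' : ℝ) • v → y = y' ∧ n = n' := by
    intro y hy y' hy' n n' h
    have hsub : y - y' = ((n' - n : ℤ) : ℝ) • v := by
      calc y - y' = (y + (n : ℝ) • v) - (n : ℝ) • v - y' := by abel
        _ = (y' + (n' : ℝ) • v) - (n : ℝ) • v - y' := by rw [h]
        _ = ((n' - n : ℤ) : ℝ) • v := by rw [Int.cast_sub, sub_smul]; abel
    have hyy : y = y' := Q.eq_of_sub_mem y hy y' hy' ((hmem _).2 ⟨n' - n, hsub⟩)
    refine ⟨hyy, ?_⟩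
    subst hyy
    rw [sub_self, eq_comm, smul_eq_zero] at hsub
    rcases hsub with h1 | h1
    · exact_mod_cast (sub_eq_zero.1 (by exact_mod_cast h1)).symm
    · exact absurd h1 hvne
  -- the kernel families `c x (y, n) = f(|x − y − n v|)` (an opaque local definition with its equation)
  obtain ⟨c, hcdef⟩ : ∃ c : EuclideanSpace ℝ (Fin 1) → (Q.motif × ℤ) → ℝ,
      c = fun x p => f (dist x (p.1.1 + (p.2 : ℝ) • v)) := ⟨_, rfl⟩
  -- (A) for a motif point `x`: `c x` is summable on `motif × ℤ` and `Σ' c x = f 0 + S(x)`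
  have hA : ∀ x : Q.motif, Summable (c x.1) ∧
      ∑' p, c x.1 p = f 0 + ∑' z : {z : EuclideanSpace ℝ (Fin 1) // z ∈ Q.points ∧ z ≠ x.1},
        f (dist x.1 z.1) := by
    intro x
    set b : Q.motif × ℤ := (x, 0) with hbdef
    -- the bijection `(y, n) ↦ y + n v` from `{p ≠ b}` onto the points `≠ x`
    have hmem_pts : ∀ p : Q.motif × ℤ, p.1.1 + (p.2 : ℝ) • v ∈ Q.points := fun p =>
      ⟨p.1.1, p.1.2, (p.2 : ℝ) • v, (hmem _).2 ⟨p.2, rfl⟩, rfl⟩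
    have hxb : x.1 = b.1.1 + (b.2 : ℝ) • v := by simp [hbdef]
    have hne_pts : ∀ p : Q.motif × ℤ, p ≠ b → p.1.1 + (p.2 : ℝ) • v ≠ x.1 := by
      intro p hp heq
      apply hp
      rw [hxb] at heq
      obtain ⟨h1, h2⟩ := huniq _ p.1.2 _ b.1.2 _ _ heq
      exact Prod.ext (Subtype.ext h1) h2
    set ex : {p : Q.motif × ℤ // p ≠ b} → {z : EuclideanSpace ℝ (Fin 1) // z ∈ Q.points ∧ z ≠ x.1} :=
      fun p => ⟨p.1.1.1 + (p.1.2 : ℝ) • v, hmem_pts p.1, hne_pts p.1 p.2⟩ with hexdef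
    have hex_bij : Function.Bijective ex := by
      constructor
      · intro p q hpq
        have h := congrArg (fun z : {z : EuclideanSpace ℝ (Fin 1) // z ∈ Q.points ∧ z ≠ x.1} => z.1) hpq
        simp only [hexdef] at h
        obtain ⟨h1, h2⟩ := huniq _ p.1.1.2 _ q.1.1.2 _ _ h
        exact Subtype.ext (Prod.ext (Subtype.ext h1) h2)
      · intro z
        obtain ⟨y, hy, g, hg, hz⟩ := z.2.1
        obtain ⟨n, rfl⟩ := (hmem g).1 hg
        have hp : ((⟨y, hy⟩, n) : Q.motif × ℤ) ≠ b := by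
          intro hpb
          apply z.2.2
          rw [hz, hxb, ← hpb]
        exact ⟨⟨(⟨y, hy⟩, n), hp⟩, Subtype.ext (by simp [hexdef, hz])⟩
    set e := Equiv.ofBijective ex hex_bij with hedef
    -- summability on `{p ≠ b}` and then on everything
    have hS := hsum x.1 (Q.mem_points_of_mem_motif x.2)
    have hsub : Summable (fun p : {p : Q.motif × ℤ // p ≠ b} => c x.1 p.1) := by
      have := (e.summable_iff.2 hS)
      refine this.congr fun p => ?_
      simp [hedef, hexdef, hcdef]
    have hcompl : Summable (fun p : ((({b} : Set (Q.motif × ℤ)))ᶜ : Set (Q.motif × ℤ)) => c x.1 p.1) := hsub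
    have hsing : Summable (fun p : (({b} : Set (Q.motif × ℤ))) => c x.1 p.1) := Summable.of_finite
    have hfull : Summable (c x.1) := hsing.add_compl hcompl
    refine ⟨hfull, ?_⟩
    -- the value: split off the point `b`
    rw [hfull.tsum_eq_add_tsum_ite b]
    have hcb : c x.1 b = f 0 := by simp [hcdef, hbdef]
    rw [hcb]
    congr 1
    -- `Σ' p, ite (p = b) 0 (c x p) = Σ' p : {p ≠ b}, c x p = S(x)`
    have h1 : ∑' p : Q.motif × ℤ, (if p = b then 0 else c x.1 p)
        = ∑' p : (({b} : Set (Q.motif × ℤ))ᶜ : Set (Q.motif × ℤ)), c x.1 p.1 := by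
      rw [tsum_subtype]
      refine tsum_congr fun p => ?_
      rw [Set.indicator_apply]
      by_cases hp : p = b
      · simp [hp]
      · rw [if_neg hp, if_pos (by simpa using hp)]
    rw [h1]
    have h2 := e.tsum_eq (fun z : {z : EuclideanSpace ℝ (Fin 1) // z ∈ Q.points ∧ z ≠ x.1} => f (dist x.1 z.1))
    rw [← h2]
    refine tsum_congr fun p => ?_
    simp [hedef, hexdef, hcdef]
  -- (B) the folded sequence `E d = Σ_{x,y} (c x (y,d) [+ c x (y,−d)])` is summable with `Σ' E = Σ_x Σ' c x`
  have hcy : ∀ x y : Q.motif, Summable (fun n : ℤ => c x.1 (y, n)) := fun x y => (hA x).1.prod_factor y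
  have hfold : ∀ x y : Q.motif, Summable (fun d : ℕ =>
      (if d = 0 then c x.1 (y, 0) else c x.1 (y, (d : ℤ)) + c x.1 (y, -(d : ℤ)))) :=
    fun x y => ppos_fold_summable (ψ := fun n : ℤ => c x.1 (y, n)) (hcy x y)
  have h3 : ∀ x : Q.motif, ∑' d : ℕ, ∑ y : Q.motif,
      (if d = 0 then c x.1 (y, 0) else c x.1 (y, (d : ℤ)) + c x.1 (y, -(d : ℤ)))
        = ∑' p : Q.motif × ℤ, c x.1 p := by
    intro x
    rw [Summable.tsum_finsetSum (fun y _ => hfold x y), (hA x).1.tsum_prod' (hcy x), tsum_fintype]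
    exact Finset.sum_congr rfl fun y _ => ppos_fold_tsum (ψ := fun n : ℤ => c x.1 (y, n)) (hcy x y)
  obtain ⟨E, hEdef⟩ : ∃ E : ℕ → ℝ, E = fun d : ℕ => ∑ x : Q.motif, ∑ y : Q.motif,
      (if d = 0 then c x.1 (y, 0) else c x.1 (y, (d : ℤ)) + c x.1 (y, -(d : ℤ))) := ⟨_, rfl⟩
  have hEapply : ∀ d : ℕ, E d = ∑ x : Q.motif, ∑ y : Q.motif,
      (if d = 0 then c x.1 (y, 0) else c x.1 (y, (d : ℤ)) + c x.1 (y, -(d : ℤ))) := fun d => by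
    rw [hEdef]
  have hEsum : Summable E := by
    rw [hEdef]
    exact summable_sum fun x _ => summable_sum fun y _ => hfold x y
  have hEtsum : ∑' d, E d = ∑ x : Q.motif, ∑' p : Q.motif × ℤ, c x.1 p := by
    rw [tsum_congr hEapply, Summable.tsum_finsetSum (fun x _ => summable_sum fun y _ => hfold x y)]
    exact Finset.sum_congr rfl fun x _ => h3 x
  -- (C) Gram sums on `K` periods: `0 ≤ Σ_{d<K} (K − d) E d`
  have hGram : ∀ K : ℕ, 0 ≤ ∑ d ∈ Finset.range K, ((K : ℝ) - d) * E d := by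
    intro K
    -- points `(x, i) ↦ x + i v`, unit weights
    have h0 := ppos_pd_fintype hpd (fun q : Q.motif × Fin K => q.1.1 + ((q.2 : ℕ) : ℝ) • v) (fun _ => 1)
    simp only [one_mul] at h0
    -- the distance only depends on `j − i`
    have hdist : ∀ (x y : Q.motif) (i j : Fin K),
        f (dist (x.1 + ((i : ℕ) : ℝ) • v) (y.1 + ((j : ℕ) : ℝ) • v))
          = c x.1 (y, ((j : ℕ) : ℤ) - ((i : ℕ) : ℤ)) := by
      intro x y i j
      rw [hcdef]
      dsimp only
      congr 1
      rw [dist_eq_norm, dist_eq_norm]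
      congr 1
      push_cast
      rw [sub_smul]
      abel
    -- per pair `(x, y)`: the counting identity
    have h2 : ∀ x y : Q.motif, ∑ i : Fin K, ∑ j : Fin K, c x.1 (y, ((j : ℕ) : ℤ) - ((i : ℕ) : ℤ))
        = ∑ d ∈ Finset.range K, ((K : ℝ) - d) *
            (if d = 0 then c x.1 (y, 0) else c x.1 (y, (d : ℤ)) + c x.1 (y, -(d : ℤ))) :=
      fun x y => ppos_counting (fun n => c x.1 (y, n)) K
    have h1 : ∑ q : Q.motif × Fin K, ∑ q' : Q.motif × Fin K,
        f (dist (q.1.1 + ((q.2 : ℕ) : ℝ) • v) (q'.1.1 + ((q'.2 : ℕ) : ℝ) • v))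
          = ∑ d ∈ Finset.range K, ((K : ℝ) - d) * E d := by
      calc ∑ q : Q.motif × Fin K, ∑ q' : Q.motif × Fin K,
            f (dist (q.1.1 + ((q.2 : ℕ) : ℝ) • v) (q'.1.1 + ((q'.2 : ℕ) : ℝ) • v))
          = ∑ x : Q.motif, ∑ i : Fin K, ∑ y : Q.motif, ∑ j : Fin K,
              c x.1 (y, ((j : ℕ) : ℤ) - ((i : ℕ) : ℤ)) := by
            rw [Fintype.sum_prod_type]
            refine Finset.sum_congr rfl fun x _ => Finset.sum_congr rfl fun i _ => ?_
            rw [Fintype.sum_prod_type]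
            exact Finset.sum_congr rfl fun y _ => Finset.sum_congr rfl fun j _ => hdist x y i j
        _ = ∑ x : Q.motif, ∑ y : Q.motif, ∑ i : Fin K, ∑ j : Fin K,
              c x.1 (y, ((j : ℕ) : ℤ) - ((i : ℕ) : ℤ)) :=
            Finset.sum_congr rfl fun x _ => Finset.sum_comm
        _ = ∑ x : Q.motif, ∑ y : Q.motif, ∑ d ∈ Finset.range K, ((K : ℝ) - d) *
              (if d = 0 then c x.1 (y, 0) else c x.1 (y, (d : ℤ)) + c x.1 (y, -(d : ℤ))) :=
            Finset.sum_congr rfl fun x _ => Finset.sum_congr rfl fun y _ => h2 x y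
        _ = ∑ x : Q.motif, ∑ d ∈ Finset.range K, ∑ y : Q.motif, ((K : ℝ) - d) *
              (if d = 0 then c x.1 (y, 0) else c x.1 (y, (d : ℤ)) + c x.1 (y, -(d : ℤ))) :=
            Finset.sum_congr rfl fun x _ => Finset.sum_comm
        _ = ∑ d ∈ Finset.range K, ∑ x : Q.motif, ∑ y : Q.motif, ((K : ℝ) - d) *
              (if d = 0 then c x.1 (y, 0) else c x.1 (y, (d : ℤ)) + c x.1 (y, -(d : ℤ))) :=
            Finset.sum_comm
        _ = ∑ d ∈ Finset.range K, ((K : ℝ) - d) * E d := by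
            refine Finset.sum_congr rfl fun d _ => ?_
            rw [hEapply, Finset.mul_sum]
            exact Finset.sum_congr rfl fun x _ => (Finset.mul_sum _ _ _).symm
    rw [← h1]
    exact h0
  -- (D) the limit: `0 ≤ Σ' E = Σ_x (f 0 + S x) = #motif·f 0 + Σ_x S x`
  have hlim := hces E hEsum
  have hEnonneg : 0 ≤ ∑' d, E d :=
    ge_of_tendsto' hlim fun K => div_nonneg (hGram K) (Nat.cast_nonneg K)
  rw [hEtsum, Finset.sum_congr rfl fun x _ => (hA x).2, Finset.sum_add_distrib, Finset.sum_const,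
    Finset.card_univ, Fintype.card_coe, nsmul_eq_mul,
    Finset.sum_coe_sort Q.motif (fun x => ∑' z : {z : EuclideanSpace ℝ (Fin 1) // z ∈ Q.points ∧ z ≠ x},
      f (dist x z.1))] at hEnonneg
  -- `f 0 / 2 + (2m)⁻¹ Σ_x S x = (2m)⁻¹ (m f 0 + Σ_x S x) ≥ 0`
  unfold PeriodicConfiguration.energyPerParticle
  generalize hSdef : (∑ x ∈ Q.motif, ∑' z : {z : EuclideanSpace ℝ (Fin 1) // z ∈ Q.points ∧ z ≠ x},
      f (dist x z.1)) = S at hEnonneg ⊢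
  have h2m : (0 : ℝ) < 2 * (Q.motif.card : ℝ) := by positivity
  have hm0 : (Q.motif.card : ℝ) ≠ 0 := hmpos.ne'
  have hhalf : (2 * (Q.motif.card : ℝ))⁻¹ * (Q.motif.card : ℝ) = 1 / 2 := by
    rw [mul_inv, mul_assoc, inv_mul_cancel₀ hm0, mul_one, one_div]
  have key : f 0 / 2 + (2 * (Q.motif.card : ℝ))⁻¹ * S
      = (2 * (Q.motif.card : ℝ))⁻¹ * ((Q.motif.card : ℝ) * f 0 + S) := by
    rw [mul_add, ← mul_assoc, hhalf]
    ring
  rw [key]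
  exact mul_nonneg (inv_nonneg.2 h2m.le) hEnonneg

end Summit.AtomisticToContinuum.Crystallization.Theorems.ThreeConeCertificateExactCertificate.Transfer1D

end
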